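import Mathlib
import Summits.QuantumFields.YangMills.Theorems.BalabanUVNodesK2Line1PrimeRemainderPrice
import Summits.QuantumFields.YangMills.Theses.BalabanUVNodes

/-!
# Sketch 2 — REFINED crux idea card of seat ym-nodeO-idea-5 (gen 2, obstruction-first) for crux K2⁷ = `stmt-QuantumFields-20543`
`Summit.QuantumFields.YangMills.Theses.BalabanUVNodes.EndpointGivenBR13SepCoPH`; card `convex-fibre-witten-semiclassics-d4`
(REFINED per CRIT-2 g0's sheet `TRIAGE-crit2-convex-fibre-witten-semiclassics-d4.md`: S-AF1 RETYPED to a MODULUS; the engine S2 TYPED as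
ISOLATED finite-dimensional statements; re-keyed to skeleton v3 LINE 1′/1″ via an4 g151 p590583 `BalabanUVNodesK2Line1PrimeRemainderPrice`).

HONEST FRAMING: the Clay YM mass gap is NOT proved by anything here; route R4 closes only the conditional finite-𝕋⁴ rung `BalabanLadder.UV`;
NODE O ([I] Thm 2 + (0.31) p.259) is UNPROVED in print; K2⁷ stays OPEN.  Every `def … : Prop` below is a hypothesis SHAPE (nothing of
Bałaban's is asserted); the `theorem`s are elementary junctions (real analysis / bookkeeping), kernel-checked, no `sorry`.

Contents
* §1 RECORD LEVEL — the engine's output in MODULUS currency relative to DEF-1's named one-loop numbers `beta0OfJs F κ`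
  (`ModPkgAt`), the proof that it delivers an4's CONSTANT-FORM package `RemAtC` (stub 2″ of line 1″) — `remAtCPkg_of_modPkgAt` — and the
  composition to the crux BY NAME `EndpointGivenBR13SepCoPH_of_line1Mod` (through `EndpointGivenBR13SepCoPH_text_of_line1C`); plus
  `modPkgAt_of_remAt` (v3's LINEAR letter `RemAt` ⟹ the modulus package: the modulus cut sits BETWEEN 2′ and 2″).
* §2 THE ISOLATED ENGINE (finite-dimensional, derivative-free typing over `Fin n → ℝ`, constants free of `n`): `CovDecayLocQuad` (2-point,
  Helffer–Sjöstrand grade), `K3TreeDecayLoc` (truncated 3-point TREE decay — the load-bearing new statement), `FirstOrderCovLin` (the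
  first-order corollary the β read-out uses: `|Cov_g − Cov_0| ≤ C·g·e^{−m r}`, from `d/dg Cov_g(F,G) = −Σ_y κ₃^{(g)}(F,G,w_y)`), and the TOY
  instance `ToyChainFirstOrder` (CRIT-2's falsifier target, 1-d chain, kit-checkable).

EDITION 2.1 (§1b, 2026-08-28T01:45Z): the NORMALISATION-COVARIANT pair answering CRIT-1 g2's `NamedJetsNormalisation.lean` — `ModPkgAtN` ∕ `ModulusAtEachJetsN13` (reference `θ.cβ · beta0OfJs F κ k`, κ AFTER θ), `RemAtCPkgN`, `D1AtModJetsN13`, PROVED `cβ_pos_of_admissible₁₃`, `remAtCPkgN_of_modPkgAtN`, ★★ `EndpointGivenBR13SepCoPH_of_line1ModN` (K2⁷ BY NAME from the repaired pair).  §1's bare-reference pair is kept as the `θ.cβ = 1` reading (`modPkgAtN_of_modPkgAt_of_cβ_eq_one`).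
-/

noncomputable section

namespace Summit.QuantumFields.YangMills.Cruxes.EndpointGivenBR13SepCoPH.Idea5

open Filter Topology MeasureTheory
open scoped BigOperators Matrix.Norms.L2Operator
open Literature.MathematicalPhysics.QuantumFieldTheory.Balaban1983to89
open Literature.MathematicalPhysics.QuantumFieldTheory.Balaban1983to89.FlowStep
open Literature.MathematicalPhysics.QuantumFieldTheory.Balaban1983to89.DagBinding (EndpointExistence)
open Literature.MathematicalPhysics.QuantumFieldTheory.Balaban1983to89.T4Continuum (T4Family)
open Literature.MathematicalPhysics.QuantumFieldTheory.Balaban1983to89.B12Beta (HistBox)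
open Literature.MathematicalPhysics.QuantumFieldTheory.Balaban1983to89.Beta.Drift (OneLoopDrift)
open Summit.QuantumFields.YangMills.Theorems.BalabanUVNodesK2JsOfRecord (StepColourData beta0OfJs BoxRemainder)
open Summit.QuantumFields.YangMills.Theorems.BalabanUVNodesK2Line1PrimeRemainderPrice

/-! ## §1 Record level: MODULUS package ⟹ an4's constant-form package `RemAtC` ⟹ K2⁷ by name -/

section Record

/-- an4 g151's CONSTANT-FORM PACKAGE `RemAtC` at the Stage-13 record for the colour datum `κ` (spelled VERBATIM from
`BalabanUVNodesK2Line1PrimeRemainderPrice` §3): box, seam `0 ≤ s ≤ stepBal 2 F.L`, constant remainder, per-scale anchor, (C), upper bound. -/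
def RemAtCPkg (F : T4Family) (κ : StepColourData) (θ : Node00.Stage13HParams F 2) (hP : θ.Provisos₁₃SepCoPH F 2) : Prop :=
  ∃ γ₀ s β' : ℝ, 0 < γ₀ ∧ γ₀ ≤ θ.γ ∧ 0 ≤ s ∧ s ≤ B12Normalization.stepBal 2 F.L ∧ 0 ≤ β' ∧
    (∀ (k : ℕ) (p : Fin (k + 1) → ℝ), p ∈ HistBox γ₀ k → |(Node00.datumOfRecord₁₃SepCoPH F 2 θ hP).βfun k p - beta0OfJs F κ k| ≤ s) ∧
    (∀ (k : ℕ) (δ : ℝ), 0 < δ → ∃ γ : ℝ, 0 < γ ∧ ∀ p : Fin (k + 1) → ℝ, p ∈ HistBox γ k →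
      |(Node00.datumOfRecord₁₃SepCoPH F 2 θ hP).βfun k p - beta0OfJs F κ k| ≤ δ) ∧
    BetaContH γ₀ (Node00.datumOfRecord₁₃SepCoPH F 2 θ hP).βfun ∧
    BetaUpperH β' γ₀ (Node00.datumOfRecord₁₃SepCoPH F 2 θ hP).βfun

/-- **THE CARD'S RETYPED CURRENCY (CRIT-2: «S-AF1 → modulus»): the MODULUS PACKAGE at the record for the colour datum `κ`.**
On some box `]0,γ₀] ⊆ ]0,θ.γ]`: `|β_{k+1}(p) − beta0OfJs F κ k| ≤ ω(p_k)` for EVERY `k` and every `]0,γ₀]`-history `p`, with ONE function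
`ω → 0` as `g → 0⁺` (k-uniform continuity at the zero history, no rate, no slope, no certified constant), together with (C) and the printed
upper bound on the box.  The Hölder instance `ω(t) = C·t^α` and the linear instance `ω(t) = C_r·t` (= v3's `RemAt` letter) are special cases. -/
def ModPkgAt (F : T4Family) (κ : StepColourData) (θ : Node00.Stage13HParams F 2) (hP : θ.Provisos₁₃SepCoPH F 2) : Prop :=
  ∃ (γ₀ β' : ℝ) (ω : ℝ → ℝ), 0 < γ₀ ∧ γ₀ ≤ θ.γ ∧ 0 ≤ β' ∧ Tendsto ω (𝓝[>] 0) (𝓝 0) ∧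
    (∀ (k : ℕ) (p : Fin (k + 1) → ℝ), p ∈ HistBox γ₀ k →
      |(Node00.datumOfRecord₁₃SepCoPH F 2 θ hP).βfun k p - beta0OfJs F κ k| ≤ ω (p (Fin.last k))) ∧
    BetaContH γ₀ (Node00.datumOfRecord₁₃SepCoPH F 2 θ hP).βfun ∧
    BetaUpperH β' γ₀ (Node00.datumOfRecord₁₃SepCoPH F 2 θ hP).βfun

/-- Stub 2ᴹ of the card's line («modulus at SOME named jets»): the shape of v3's `RemAtSomeJets` with the letter replaced by the modulus package. -/
def ModulusAtSomeJets13 : Prop :=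
  ∀ F : T4Family, ∃ κ : StepColourData, ∀ (θ : Node00.Stage13HParams F 2) (hP : θ.Provisos₁₃SepCoPH F 2), θ.Admissible F 2 → ModPkgAt F κ θ hP

/-- Stub 2″ of an4's line 1″ (`RemAtCSomeJets`), by name. -/
def RemAtCSomeJets13 : Prop :=
  ∀ F : T4Family, ∃ κ : StepColourData, ∀ (θ : Node00.Stage13HParams F 2) (hP : θ.Provisos₁₃SepCoPH F 2), θ.Admissible F 2 → RemAtCPkg F κ θ hP

/-- Stub 1″ of an4's line 1″ (`D1AtShadowingJetsC`): row (D1) carried by the named jets, hypothesis = the constant-form package. -/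
def D1AtShadowingJetsC13 : Prop :=
  ∀ (F : T4Family) (κ : StepColourData) (θ : Node00.Stage13HParams F 2) (hP : θ.Provisos₁₃SepCoPH F 2), θ.Admissible F 2 →
    RemAtCPkg F κ θ hP → ∃ A : ℝ, OneLoopDrift (B12Normalization.stepBal 2 F.L) A (beta0OfJs F κ)

/-- The T4 family's block has `1 < L`, so the SU(2) one-loop step slope is positive: `0 < stepBal 2 F.L`. -/
theorem stepBal_two_pos (F : T4Family) : 0 < B12Normalization.stepBal 2 (F.L : ℝ) :=
  B12Normalization.stepBal_pos (by norm_num) (by exact_mod_cast F.hL.2)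

/-- From `ω → 0` at `0⁺`: for every `ε > 0` some `u > 0` with `ω t < ε` for all `t ∈ ]0, u[`. -/
theorem exists_Ioo_of_tendsto {ω : ℝ → ℝ} (hω : Tendsto ω (𝓝[>] 0) (𝓝 0)) {ε : ℝ} (hε : 0 < ε) :
    ∃ u : ℝ, 0 < u ∧ ∀ t : ℝ, 0 < t → t < u → ω t < ε := by
  have hmem : ω ⁻¹' Set.Iio ε ∈ 𝓝[>] (0 : ℝ) := hω (Iio_mem_nhds hε)
  obtain ⟨u, hu, hsub⟩ := mem_nhdsGT_iff_exists_Ioo_subset.mp hmem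
  exact ⟨u, hu, fun t ht htu => hsub ⟨ht, htu⟩⟩

/-- **★ MODULUS ⟹ an4's CONSTANT-FORM PACKAGE** (so the card's stub 2ᴹ discharges stub 2″ of line 1″): shrink the box until `ω < stepBal 2 F.L`
(constant remainder with the seam), and for each `δ` until `ω < δ` (per-scale anchor — here even k-uniform); (C) and the upper bound restrict. -/
theorem remAtCPkg_of_modPkgAt (F : T4Family) (κ : StepColourData) (θ : Node00.Stage13HParams F 2) (hP : θ.Provisos₁₃SepCoPH F 2)
    (h : ModPkgAt F κ θ hP) : RemAtCPkg F κ θ hP := by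
  obtain ⟨γ₀, β', ω, hγ₀, hle, hβ', hω, hmod, hcont, hup⟩ := h
  have hs := stepBal_two_pos F
  obtain ⟨u, hu, hωu⟩ := exists_Ioo_of_tendsto hω hs
  set γ₁ : ℝ := min γ₀ (u / 2) with hγ₁
  have hγ₁pos : 0 < γ₁ := lt_min hγ₀ (by linarith)
  have hγ₁le : γ₁ ≤ γ₀ := min_le_left _ _
  have hsub : ∀ k (p : Fin (k + 1) → ℝ), p ∈ HistBox γ₁ k → p ∈ HistBox γ₀ k :=
    fun k p hp i => ⟨(hp i).1, (hp i).2.trans hγ₁le⟩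
  refine ⟨γ₁, B12Normalization.stepBal 2 F.L, β', hγ₁pos, hγ₁le.trans hle, hs.le, le_rfl, hβ', ?_, ?_, ?_, ?_⟩
  · intro k p hp
    have hlast : 0 < p (Fin.last k) ∧ p (Fin.last k) ≤ γ₁ := hp (Fin.last k)
    have hlt : p (Fin.last k) < u := lt_of_le_of_lt (hlast.2.trans (min_le_right _ _)) (by linarith)
    exact (hmod k p (hsub k p hp)).trans (hωu _ hlast.1 hlt).le
  · intro k δ hδ
    obtain ⟨u', hu', hωu'⟩ := exists_Ioo_of_tendsto hω hδ
    refine ⟨min γ₀ (u' / 2), lt_min hγ₀ (by linarith), fun p hp => ?_⟩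
    have hp₀ : p ∈ HistBox γ₀ k := fun i => ⟨(hp i).1, (hp i).2.trans (min_le_left _ _)⟩
    have hlast : 0 < p (Fin.last k) ∧ p (Fin.last k) ≤ min γ₀ (u' / 2) := hp (Fin.last k)
    have hlt : p (Fin.last k) < u' := lt_of_le_of_lt (hlast.2.trans (min_le_right _ _)) (by linarith)
    exact (hmod k p hp₀).trans (hωu' _ hlast.1 hlt).le
  · exact fun k => (hcont k).mono (box_mono hγ₁le k)
  · exact fun k v hv => hup k v (box_mono hγ₁le k hv)

/-- Stub-level: 2ᴹ ⟹ 2″. -/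
theorem remAtCSomeJets13_of_modulusAtSomeJets13 (h : ModulusAtSomeJets13) : RemAtCSomeJets13 := by
  intro F
  obtain ⟨κ, hκ⟩ := h F
  exact ⟨κ, fun θ hP hθ => remAtCPkg_of_modPkgAt F κ θ hP (hκ θ hP hθ)⟩

/-- v3's LINEAR letter (`BoxRemainder … C_r γ₀`, `0 ≤ C_r`, with (C) and the upper bound; the seam clause is NOT needed) ⟹ the modulus package with
`ω t := C_r·t` — so the modulus cut 2ᴹ sits BETWEEN the registered 2′ (`RemAt`) and an4's 2″ (`RemAtC`). -/
theorem modPkgAt_of_remAt (F : T4Family) (κ : StepColourData) (θ : Node00.Stage13HParams F 2) (hP : θ.Provisos₁₃SepCoPH F 2)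
    (h : ∃ γ₀ Cr β' : ℝ, 0 < γ₀ ∧ γ₀ ≤ θ.γ ∧ 0 ≤ Cr ∧ 0 ≤ β' ∧
      BoxRemainder (Node00.datumOfRecord₁₃SepCoPH F 2 θ hP).βfun (beta0OfJs F κ) Cr γ₀ ∧
      BetaContH γ₀ (Node00.datumOfRecord₁₃SepCoPH F 2 θ hP).βfun ∧
      BetaUpperH β' γ₀ (Node00.datumOfRecord₁₃SepCoPH F 2 θ hP).βfun) : ModPkgAt F κ θ hP := by
  obtain ⟨γ₀, Cr, β', hγ₀, hle, hCr, hβ', hrem, hcont, hup⟩ := h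
  refine ⟨γ₀, β', fun t => Cr * t, hγ₀, hle, hβ', ?_, fun k p hp => hrem k p hp, hcont, hup⟩
  have : Tendsto (fun t : ℝ => Cr * t) (𝓝 0) (𝓝 (Cr * 0)) := (continuous_const.mul continuous_id).tendsto 0
  rw [mul_zero] at this
  exact this.mono_left nhdsWithin_le_nhds

/-- **★★ THE CARD'S LINE REACHES THE CRUX BY NAME**: {1″ `D1AtShadowingJetsC13` (row (D1), shared with line 1′/1″ — NOT this card's business),
2ᴹ `ModulusAtSomeJets13` (this card's engine output)} ⟹ K2⁷, through an4's `EndpointGivenBR13SepCoPH_text_of_line1C`. -/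
theorem EndpointGivenBR13SepCoPH_of_line1Mod (h₁ : D1AtShadowingJetsC13) (h₂ : ModulusAtSomeJets13) :
    Summit.QuantumFields.YangMills.Theses.BalabanUVNodes.EndpointGivenBR13SepCoPH :=
  EndpointGivenBR13SepCoPH_text_of_line1C h₁ (remAtCSomeJets13_of_modulusAtSomeJets13 h₂)

end Record

/-! ## §2 The ISOLATED ENGINE — finite-dimensional statements over `Fin n → ℝ`, constants free of `n` (what a refuter attacks)

Derivative-free typing: uniform convexity as a midpoint inequality, finite range as a decomposition into pieces depending on sets of
`d`-diameter `≤ R`, upper Hessian control of the pieces as a second-difference bound.  `d` is a pseudo-metric on the sites with dimension-4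
volume growth `G`.  The Gibbs functional is the normalised Lebesgue integral against `exp (−φ)` on `ℝⁿ` (a convex soft wall is part of `φ`). -/

section Engine

variable {n : ℕ}

/-- Gibbs expectation `⟨F⟩_φ = ∫ F e^{−φ} ∕ ∫ e^{−φ}` on `ℝⁿ = Fin n → ℝ` (Lebesgue). -/
def gE (φ F : (Fin n → ℝ) → ℝ) : ℝ := (∫ x, F x * Real.exp (-φ x)) / ∫ x, Real.exp (-φ x)

/-- Truncated 2-point function. -/
def gCov (φ F G : (Fin n → ℝ) → ℝ) : ℝ := gE φ (fun x => F x * G x) - gE φ F * gE φ G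

/-- Truncated 3-point function (third joint cumulant). -/
def gK3 (φ F G H : (Fin n → ℝ) → ℝ) : ℝ :=
  gE φ (fun x => (F x - gE φ F) * (G x - gE φ G) * (H x - gE φ H))

/-- `d` is a pseudo-metric on the sites. -/
def SitePseudoMetric (d : Fin n → Fin n → ℝ) : Prop :=
  ∀ i j k, 0 ≤ d i j ∧ d i i = 0 ∧ d i j = d j i ∧ d i k ≤ d i j + d j k

/-- Dimension-4 volume growth with constant `G`: balls of radius `r` have at most `G (1+r)^4` sites. -/
def Growth4 (G : ℝ) (d : Fin n → Fin n → ℝ) : Prop :=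
  ∀ (i : Fin n) (r : ℝ), 0 ≤ r → ((Finset.univ.filter fun j => d i j ≤ r).card : ℝ) ≤ G * (1 + r) ^ 4

/-- Uniform convexity with modulus `c₀` (midpoint form: for `C²` functions ⟺ `Hess φ ≥ c₀`). -/
def UConvex (c₀ : ℝ) (φ : (Fin n → ℝ) → ℝ) : Prop :=
  ∀ x y : Fin n → ℝ, φ (fun i => (x i + y i) / 2) ≤ (φ x + φ y) / 2 - c₀ / 8 * ∑ i, (x i - y i) ^ 2

/-- `F` depends only on the coordinates in `S`. -/
def DependsOn (S : Finset (Fin n)) (F : (Fin n → ℝ) → ℝ) : Prop :=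
  ∀ x y : Fin n → ℝ, (∀ i ∈ S, x i = y i) → F x = F y

/-- Finite range `R` with piecewise upper Hessian bound `C₂`: `φ` is a finite sum of pieces, each depending on a set of `d`-diameter `≤ R`
and with second differences `≤ C₂·|h|²` along that set (for `C²` pieces ⟺ `Hess ψ_a ≤ C₂`). -/
def FiniteRangeC2 (d : Fin n → Fin n → ℝ) (R C₂ : ℝ) (φ : (Fin n → ℝ) → ℝ) : Prop :=
  ∃ (m : ℕ) (S : Fin m → Finset (Fin n)) (ψ : Fin m → (Fin n → ℝ) → ℝ),
    (∀ a, ∀ i ∈ S a, ∀ j ∈ S a, d i j ≤ R) ∧ (∀ a, DependsOn (S a) (ψ a)) ∧ (∀ a, Continuous (ψ a)) ∧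
    (∀ a (x h : Fin n → ℝ), ψ a (x + h) + ψ a (x - h) - 2 * ψ a x ≤ C₂ * ∑ i ∈ S a, h i ^ 2) ∧
    φ = fun x => ∑ a, ψ a x

/-- Local polynomial observable of degree `≤ 4` on the site set `S` with coefficient bound `a` (covers the quadratic read-out observables
`∂_B φ` and the cubic∕quartic pieces `w_y` of the perturbation `W`). -/
def LocPoly4 (S : Finset (Fin n)) (a : ℝ) (F : (Fin n → ℝ) → ℝ) : Prop :=
  ∃ (q : (Fin 4 → Fin n) → ℝ) (c : (Fin 4 → Fin n) → Fin 4 → Bool),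
    (∀ ι, q ι ≠ 0 → ∀ l, ι l ∈ S) ∧ (∀ ι, |q ι| ≤ a) ∧
    F = fun x => ∑ ι, q ι * ∏ l, (if c ι l then x (ι l) else 1)

/-- The hypothesis bundle of the engine at constants `(c₀, R, C₂, G)`: pseudo-metric, growth, continuity, uniform convexity, finite range,
and the fibre minimiser at the origin (Bałaban's background IS the constrained minimiser, so the fluctuation phase is minimised at `X = 0`). -/
def EngineHyp (c₀ R C₂ G : ℝ) (d : Fin n → Fin n → ℝ) (φ : (Fin n → ℝ) → ℝ) : Prop :=
  SitePseudoMetric d ∧ Growth4 G d ∧ Continuous φ ∧ UConvex c₀ φ ∧ FiniteRangeC2 d R C₂ φ ∧ ∀ x, φ 0 ≤ φ x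

/-- **S2a (2-point, Helffer–Sjöstrand grade, n-FREE)**: truncated 2-point functions of local degree-≤4 observables decay exponentially in the
`d`-distance of their supports, with constants depending only on `(c₀, R, C₂, G, a)` — NOT on `n`, NOT on `φ` otherwise. -/
def CovDecayLocQuad : Prop :=
  ∀ c₀ R C₂ G a : ℝ, 0 < c₀ → 0 ≤ R → 0 ≤ C₂ → 0 ≤ G → 0 ≤ a → ∃ C m : ℝ, 0 ≤ C ∧ 0 < m ∧
    ∀ (n : ℕ) (d : Fin n → Fin n → ℝ) (φ : (Fin n → ℝ) → ℝ), EngineHyp c₀ R C₂ G d φ →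
      ∀ (S T : Finset (Fin n)) (F Gobs : (Fin n → ℝ) → ℝ) (r : ℝ), LocPoly4 S a F → LocPoly4 T a Gobs →
        (∀ i ∈ S, ∀ j ∈ T, r ≤ d i j) → |gCov φ F Gobs| ≤ C * S.card * T.card * Real.exp (-(m * r))

/-- **S2b (LOAD-BEARING, n-FREE TREE DECAY OF THE THIRD CUMULANT)**: for three local degree-≤4 observables with pairwise support distances
`≥ r₁₂, r₂₃, r₁₃`, `|κ₃| ≤ C·|S₁||S₂||S₃|·exp(−m (r₁₂+r₂₃+r₁₃)/2)` (half-perimeter ≤ Steiner tree length), constants depending only on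
`(c₀, R, C₂, G, a)`.  Mechanism (not asserted here): iterate the Helffer–Sjöstrand representation `Cov(F,G) = ∫⟨∇F, 𝔚_φ⁻¹ ∇G⟩ dμ`,
`𝔚_φ ≥ Hess φ ≥ c₀` with finite-range off-diagonal ⇒ Combes–Thomas decay in the SITE index, dimension-free. -/
def K3TreeDecayLoc : Prop :=
  ∀ c₀ R C₂ G a : ℝ, 0 < c₀ → 0 ≤ R → 0 ≤ C₂ → 0 ≤ G → 0 ≤ a → ∃ C m : ℝ, 0 ≤ C ∧ 0 < m ∧
    ∀ (n : ℕ) (d : Fin n → Fin n → ℝ) (φ : (Fin n → ℝ) → ℝ), EngineHyp c₀ R C₂ G d φ →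
      ∀ (S₁ S₂ S₃ : Finset (Fin n)) (F₁ F₂ F₃ : (Fin n → ℝ) → ℝ) (r₁₂ r₂₃ r₁₃ : ℝ),
        LocPoly4 S₁ a F₁ → LocPoly4 S₂ a F₂ → LocPoly4 S₃ a F₃ →
        (∀ i ∈ S₁, ∀ j ∈ S₂, r₁₂ ≤ d i j) → (∀ i ∈ S₂, ∀ j ∈ S₃, r₂₃ ≤ d i j) → (∀ i ∈ S₁, ∀ j ∈ S₃, r₁₃ ≤ d i j) →
        |gK3 φ F₁ F₂ F₃| ≤ C * S₁.card * S₂.card * S₃.card * Real.exp (-(m * (r₁₂ + r₂₃ + r₁₃) / 2))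

/-- A LOCAL PERTURBATION `W = Σ_y w_y`: one degree-≤4 piece per site `y`, supported in the `R`-ball of `y`, coefficient bound `a`. -/
def LocalPerturbation (d : Fin n → Fin n → ℝ) (R a : ℝ) (W : (Fin n → ℝ) → ℝ) : Prop :=
  ∃ w : Fin n → (Fin n → ℝ) → ℝ, (∀ y, LocPoly4 (Finset.univ.filter fun j => d y j ≤ R) a (w y)) ∧ W = fun x => ∑ y, w y x

/-- **S2c (THE FIRST-ORDER COROLLARY THE β READ-OUT USES, n-FREE, LINEAR IN g)**: along a segment `φ_g = φ₀ + g·W`, `g ∈ [0, g₁]`, on which the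
engine hypotheses hold UNIFORMLY (same constants for every `g` — the convex window keeps `g·Hess W` small), truncated 2-point functions of local
observables move by at most `C·g·e^{−m r}`: from `d/dg Cov_g(F,G) = −κ₃^{(g)}(F,G,W) = −Σ_y κ₃^{(g)}(F,G,w_y)` and S2b summed over `y` with `Growth4`. -/
def FirstOrderCovLin : Prop :=
  ∀ c₀ R C₂ G a : ℝ, 0 < c₀ → 0 ≤ R → 0 ≤ C₂ → 0 ≤ G → 0 ≤ a → ∃ C m : ℝ, 0 ≤ C ∧ 0 < m ∧
    ∀ (n : ℕ) (d : Fin n → Fin n → ℝ) (φ₀ W : (Fin n → ℝ) → ℝ) (g₁ : ℝ), 0 ≤ g₁ → LocalPerturbation d R a W →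
      (∀ g : ℝ, 0 ≤ g → g ≤ g₁ → EngineHyp c₀ R C₂ G d (fun x => φ₀ x + g * W x)) →
      ∀ (S T : Finset (Fin n)) (F Gobs : (Fin n → ℝ) → ℝ) (r g : ℝ), LocPoly4 S a F → LocPoly4 T a Gobs →
        (∀ i ∈ S, ∀ j ∈ T, r ≤ d i j) → 0 ≤ g → g ≤ g₁ →
        |gCov (fun x => φ₀ x + g * W x) F Gobs - gCov φ₀ F Gobs| ≤ C * g * S.card * T.card * Real.exp (-(m * r))

/-- Second-moment READ-OUT is then LINEAR in `g` with an n-free constant (the shape (1.22) p.264 integrates): an exponentially decaying kernel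
perturbation of size `C·g·e^{−m|x|}` on `ℤ⁴`-like site sets has second moments `O(g)` — elementary given `Growth4`; recorded as the target shape. -/
def SecondMomentLin : Prop :=
  ∀ (G m C : ℝ), 0 ≤ G → 0 < m → 0 ≤ C → ∃ A : ℝ, 0 ≤ A ∧ ∀ (n : ℕ) (d : Fin n → Fin n → ℝ), SitePseudoMetric d → Growth4 G d →
    ∀ (K : Fin n → ℝ) (i₀ : Fin n) (g : ℝ), 0 ≤ g → (∀ j, |K j| ≤ C * g * Real.exp (-(m * d i₀ j))) →
      |∑ j, K j * d i₀ j ^ 2| ≤ A * g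

/-- **TOY (CRIT-2's falsifier target, kit-checkable; 1-d periodic chain, window `[−ρ,ρ]ⁿ`)**: `φ_{n,g}(x) = Σ_i [x_i²/2 + c/2·(x_i − x_{i+1})²]
+ g·Σ_i (x_i³ + x_i⁴)` restricted to the window (convex there for `g ≤ g₁(ρ)`); read-out `M_{n,g} := Σ_i dist(0,i)²·Cov_{n,g}(x_0², x_i²)`.
CLAIM: `|M_{n,g} − M_{n,0}| ≤ C·g` with `C` INDEPENDENT of `n` (the quartic piece makes the first-order term non-zero; the cubic alone would be
`O(g²)` by parity). -/
def toyPhi (n : ℕ) (c g : ℝ) (x : Fin (n + 1) → ℝ) : ℝ :=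
  ∑ i : Fin (n + 1), (x i ^ 2 / 2 + c / 2 * (x i - x (i + 1)) ^ 2) + g * ∑ i : Fin (n + 1), (x i ^ 3 + x i ^ 4)

/-- Window-restricted Gibbs expectation of the toy (Lebesgue on the cube `[−ρ,ρ]^{n+1}`). -/
def toyE (n : ℕ) (c g ρ : ℝ) (F : (Fin (n + 1) → ℝ) → ℝ) : ℝ :=
  (∫ x in Set.pi Set.univ (fun _ => Set.Icc (-ρ) ρ), F x * Real.exp (-toyPhi n c g x)) /
    ∫ x in Set.pi Set.univ (fun _ => Set.Icc (-ρ) ρ), Real.exp (-toyPhi n c g x)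

/-- Toy truncated 2-point function of the squares at sites `0` and `i`. -/
def toyCovSq (n : ℕ) (c g ρ : ℝ) (i : Fin (n + 1)) : ℝ :=
  toyE n c g ρ (fun x => x 0 ^ 2 * x i ^ 2) - toyE n c g ρ (fun x => x 0 ^ 2) * toyE n c g ρ (fun x => x i ^ 2)

/-- Cyclic distance from `0` to `i` on `ℤ∕(n+1)`. -/
def cycDist (n : ℕ) (i : Fin (n + 1)) : ℝ := min (i : ℕ) (n + 1 - (i : ℕ))

/-- Toy second-moment read-out `M_{n,g}`. -/
def toyM (n : ℕ) (c g ρ : ℝ) : ℝ := ∑ i : Fin (n + 1), cycDist n i ^ 2 * toyCovSq n c g ρ i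

/-- **TOY CLAIM** (n-uniform first-order bound for the read-out). -/
def ToyChainFirstOrder : Prop :=
  ∀ c ρ : ℝ, 0 ≤ c → 0 < ρ → ∃ g₁ C : ℝ, 0 < g₁ ∧ 0 ≤ C ∧ ∀ (n : ℕ) (g : ℝ), 0 ≤ g → g ≤ g₁ →
    |toyM n c g ρ - toyM n c 0 ρ| ≤ C * g

end Engine

/-! ## §3 Where §2 lands in §1 (the READ-OUT step S3, stated as a shape; P4 of CRIT-2's price)

The record's `β_{k+1}(p) − b_k` is the `(μ,ν)`-second moment (1.22) of the difference of two polarised kernels: the fibre covariance of the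
quadratic observables `∂_B φ_B` at `g = p_k` and at `g = 0` (Gaussian fibre = the one-loop number).  `FirstOrderCovLin` + `SecondMomentLin` give
`|β_{k+1}(p) − b_k| ≤ C·p_k` with `C` free of `k` PROVIDED the engine constants `(c₀, R, C₂, G, a)` of the scale-`k` fibre are k-free along free
in-box histories (CRIT-2's F4 ∕ P2) — i.e. the LINEAR letter of v3's `RemAt` (hence `ModPkgAt` by `modPkgAt_of_remAt`).  The identification of the
Gaussian-fibre number with `beta0OfJs F κ` for SOME colour datum `κ` is DEF-1's read-out question (shared with line 1′), not this card's lever. -/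

/-! ## §1b (EDITION 2.1) THE NORMALISATION-COVARIANT PAIR — answers CRIT-1 g2's follow-through
(`Cruxes/EndpointGivenBR13SepCoPH/NamedJetsNormalisation.lean`, 01:06Z: the record's β carries the FREE chart constant `θ.cβ`, so the F-level
shape `∀ F ∃ κ ∀ θ` with the bare reference `beta0OfJs F κ` — v3's 2′, an4's 2″, hence §1's 2ᴹ which implies 2″ — is stub-misstated modulo
`TwoNormalisations`; CRIT-1's repair `RemAtN` ∕ `RemAtNEachJets`: reference `θ.cβ · beta0OfJs F κ k`, κ AFTER θ).  The modulus grade is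
repaired the same way; the seam it needs, `0 < θ.cβ · stepBal 2 F.L`, is free: Stage-9 admissibility carries `0 < θ.cβ`
(`Node00.Stage9Params.Admissible.chart`).  CRIT-2 g2's landed `Theorems/EndpointGivenBR13SepCoPH/Negative/Anchor13FalseOfTwoBaseHistories`
(zero-history anchors; `af1AtRecord13_false_of_twoBaseHistories` kills EDITION 1's `AF1AtRecord13`) touches nothing here: every statement
lives on boxes `]0,γ₀]^{k+1}` at NAMED numbers and never reads a zero-history value. -/

section RecordN

variable (F : T4Family) (κ : StepColourData) (θ : Node00.Stage13HParams F 2) (hP : θ.Provisos₁₃SepCoPH F 2)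

/-- Stage-13 admissibility carries the chart clause of record with `0 < θ.cβ` (Stage 9). [cite: Balaban1987RG1, (1.20)–(1.22) p.264 (bookkeeping)] -/
theorem cβ_pos_of_admissible₁₃ {F : T4Family} {θ : Node00.Stage13HParams F 2} (hθ : θ.Admissible F 2) : 0 < θ.cβ :=
  hθ.toStage12.toStage9.chart.1

/-- The CONSTANT-FORM package with the normalisation CARRIED: an4's `RemAtC` text with reference numbers `θ.cβ · beta0OfJs F κ k` and seam
`s ≤ θ.cβ · stepBal 2 F.L` (the constant-form twin of CRIT-1's `RemAtN`). [folklore] -/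
def RemAtCPkgN : Prop :=
  ∃ γ₀ s β' : ℝ, 0 < γ₀ ∧ γ₀ ≤ θ.γ ∧ 0 ≤ s ∧ s ≤ θ.cβ * B12Normalization.stepBal 2 F.L ∧ 0 ≤ β' ∧
    (∀ (k : ℕ) (p : Fin (k + 1) → ℝ), p ∈ HistBox γ₀ k → |(Node00.datumOfRecord₁₃SepCoPH F 2 θ hP).βfun k p - θ.cβ * beta0OfJs F κ k| ≤ s) ∧
    (∀ (k : ℕ) (δ : ℝ), 0 < δ → ∃ γ : ℝ, 0 < γ ∧ ∀ p : Fin (k + 1) → ℝ, p ∈ HistBox γ k →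
      |(Node00.datumOfRecord₁₃SepCoPH F 2 θ hP).βfun k p - θ.cβ * beta0OfJs F κ k| ≤ δ) ∧
    BetaContH γ₀ (Node00.datumOfRecord₁₃SepCoPH F 2 θ hP).βfun ∧
    BetaUpperH β' γ₀ (Node00.datumOfRecord₁₃SepCoPH F 2 θ hP).βfun

/-- **THE CARD'S CURRENCY, NORMALISATION CARRIED (edition 2.1)**: §1's `ModPkgAt` with reference numbers `θ.cβ · beta0OfJs F κ k`. [folklore] -/
def ModPkgAtN : Prop :=
  ∃ (γ₀ β' : ℝ) (ω : ℝ → ℝ), 0 < γ₀ ∧ γ₀ ≤ θ.γ ∧ 0 ≤ β' ∧ Tendsto ω (𝓝[>] 0) (𝓝 0) ∧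
    (∀ (k : ℕ) (p : Fin (k + 1) → ℝ), p ∈ HistBox γ₀ k →
      |(Node00.datumOfRecord₁₃SepCoPH F 2 θ hP).βfun k p - θ.cβ * beta0OfJs F κ k| ≤ ω (p (Fin.last k))) ∧
    BetaContH γ₀ (Node00.datumOfRecord₁₃SepCoPH F 2 θ hP).βfun ∧
    BetaUpperH β' γ₀ (Node00.datumOfRecord₁₃SepCoPH F 2 θ hP).βfun

/-- REPAIRED stub 2ᴹᴺ (κ AFTER θ, normalisation carried): at every proviso-carrying admissible Stage-13 tuple, SOME colour datum's normalised
one-loop numbers shadow the β of record to modulus grade, k-uniformly, with (C) and (U) on the box. [folklore] -/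
def ModulusAtEachJetsN13 : Prop :=
  ∀ (F : T4Family) (θ : Node00.Stage13HParams F 2) (hP : θ.Provisos₁₃SepCoPH F 2), θ.Admissible F 2 → ∃ κ : StepColourData, ModPkgAtN F κ θ hP

/-- REPAIRED stub 1ᴹᴺ = row (D1) keyed on the normalised modulus package: the NAMED numbers drift with the bare slope `stepBal 2 F.L`
(discharged by «row (D1) at the colour data the stub names», hypothesis then unused — as an4's `d1AtShadowingJetsC_of_d1Drift_all`). [folklore] -/
def D1AtModJetsN13 : Prop :=
  ∀ (F : T4Family) (κ : StepColourData) (θ : Node00.Stage13HParams F 2) (hP : θ.Provisos₁₃SepCoPH F 2), θ.Admissible F 2 →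
    ModPkgAtN F κ θ hP → ∃ A : ℝ, OneLoopDrift (B12Normalization.stepBal 2 F.L) A (beta0OfJs F κ)

/-- Drift rescales (CRIT-1's `oneLoopDrift_const_mul`, re-proved here to stay import-free of crux workfiles). [folklore] -/
theorem oneLoopDrift_const_mul' {s A : ℝ} {b : ℕ → ℝ} (h : OneLoopDrift s A b) (c : ℝ) :
    OneLoopDrift (c * s) (|c| * A) (fun k => c * b k) := by
  intro k
  rw [← Finset.mul_sum, mul_assoc, ← mul_sub, abs_mul]
  exact mul_le_mul_of_nonneg_left (h k) (abs_nonneg c)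

/-- ★ MODULUS ⟹ CONSTANT FORM, normalisation carried: shrink the box until `ω ≤ θ.cβ · stepBal 2 F.L` (needs only `0 < θ.cβ`) and, per `δ`,
until `ω ≤ δ` — the per-scale anchor comes out k-UNIFORM. [folklore] -/
theorem remAtCPkgN_of_modPkgAtN (hc : 0 < θ.cβ) (h : ModPkgAtN F κ θ hP) : RemAtCPkgN F κ θ hP := by
  obtain ⟨γ₀, β', ω, hγ₀, hle, hβ', hω, hmod, hcont, hup⟩ := h
  have hs : 0 < θ.cβ * B12Normalization.stepBal 2 F.L := mul_pos hc (stepBal_two_pos F)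
  obtain ⟨u, hu, hωu⟩ := exists_Ioo_of_tendsto hω hs
  set γ₁ : ℝ := min γ₀ (u / 2) with hγ₁
  have hγ₁pos : 0 < γ₁ := lt_min hγ₀ (by linarith)
  have hγ₁le : γ₁ ≤ γ₀ := min_le_left _ _
  have hsub : ∀ k (p : Fin (k + 1) → ℝ), p ∈ HistBox γ₁ k → p ∈ HistBox γ₀ k :=
    fun k p hp i => ⟨(hp i).1, (hp i).2.trans hγ₁le⟩
  refine ⟨γ₁, θ.cβ * B12Normalization.stepBal 2 F.L, β', hγ₁pos, hγ₁le.trans hle, hs.le, le_rfl, hβ', ?_, ?_, ?_, ?_⟩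
  · intro k p hp
    have hlast : 0 < p (Fin.last k) ∧ p (Fin.last k) ≤ γ₁ := hp (Fin.last k)
    have hlt : p (Fin.last k) < u := lt_of_le_of_lt (hlast.2.trans (min_le_right _ _)) (by linarith)
    exact (hmod k p (hsub k p hp)).trans (hωu _ hlast.1 hlt).le
  · intro k δ hδ
    obtain ⟨u', hu', hωu'⟩ := exists_Ioo_of_tendsto hω hδ
    refine ⟨min γ₀ (u' / 2), lt_min hγ₀ (by linarith), fun p hp => ?_⟩
    have hp₀ : p ∈ HistBox γ₀ k := fun i => ⟨(hp i).1, (hp i).2.trans (min_le_left _ _)⟩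
    have hlast : 0 < p (Fin.last k) ∧ p (Fin.last k) ≤ min γ₀ (u' / 2) := hp (Fin.last k)
    have hlt : p (Fin.last k) < u' := lt_of_le_of_lt (hlast.2.trans (min_le_right _ _)) (by linarith)
    exact (hmod k p hp₀).trans (hωu' _ hlast.1 hlt).le
  · exact fun k => (hcont k).mono (box_mono hγ₁le k)
  · exact fun k v hv => hup k v (box_mono hγ₁le k hv)

/-- The bare-reference package of §1 is the `θ.cβ = 1` reading of the normalised one (records of record take `cβ := 1`). [folklore] -/
theorem modPkgAtN_of_modPkgAt_of_cβ_eq_one (hc : θ.cβ = 1) (h : ModPkgAt F κ θ hP) : ModPkgAtN F κ θ hP := by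
  obtain ⟨γ₀, β', ω, hγ₀, hle, hβ', hω, hmod, hcont, hup⟩ := h
  exact ⟨γ₀, β', ω, hγ₀, hle, hβ', hω, fun k p hp => by simpa [hc] using hmod k p hp, hcont, hup⟩

/-- ★★ **THE REPAIRED MODULUS PAIR CLOSES K2⁷ BY NAME** (normalisation carried, κ after θ; END via DEF-1 ∕ an4's constant-form drift lemma with the
drift rescaled by `θ.cβ` — the END accepts any slope; the seam is free from `0 < θ.cβ` and `1 < L`). [folklore] -/
theorem EndpointGivenBR13SepCoPH_of_line1ModN (h₁ : D1AtModJetsN13) (h₂ : ModulusAtEachJetsN13) :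
    Summit.QuantumFields.YangMills.Theses.BalabanUVNodes.EndpointGivenBR13SepCoPH := by
  intro F θ hP _hU hθ _hB _hwin
  obtain ⟨κ, hMod⟩ := h₂ F θ hP hθ
  obtain ⟨A, hdrift⟩ := h₁ F κ θ hP hθ hMod
  have hc : 0 < θ.cβ := cβ_pos_of_admissible₁₃ hθ
  obtain ⟨γ₁, s, β', hγ₁, -, -, hseam, hβ', hrem, -, hcont, hup⟩ := remAtCPkgN_of_modPkgAtN F κ θ hP hc hMod
  exact endpointExistence_of_drift_constRemainder (Node00.datumOfRecord₁₃SepCoPH F 2 θ hP).fwd hγ₁ (oneLoopDrift_const_mul' hdrift θ.cβ)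
    hrem hseam hβ' hcont hup

end RecordN


end Summit.QuantumFields.YangMills.Cruxes.EndpointGivenBR13SepCoPH.Idea5

end
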